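import Literature.AlgebraicTopology.SingularHomology.ShuffleChains
import Literature.Geometry.Manifold.CubeToSimplex
import Mathlib.Analysis.Calculus.ContDiff.Operations
import HarnessLib

/-!
# The shuffle simplices in cube coordinates

Topic `Literature/Geometry/Manifold`. Calculus support for the comparison of the de Rham (wedge)
product with the Alexander–Whitney cup product through the Eilenberg–Zilber shuffle product
(`…SingularHomology.ShuffleChains`, `…EilenbergZilberChains`): the tree integrates forms over a
singular `k`-simplex through the **collapsed cube** `cubeToSimplex k : [0,1]ᵏ → Δᵏ`
(`…Manifold.CubeToSimplex`, `c_{k+1}(t₀,t') = (1 - t₀, t₀ · c_k t')`), and a shuffle simplex of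
`σ × τ` is `(σ ∘ 𝔄_w, τ ∘ 𝔅_w)` for the linear vertex-label maps `𝔄_w x = ∑ⱼ xⱼ e_{aⱼ}`,
`𝔅_w x = ∑ⱼ xⱼ e_{bⱼ}` of a lattice path `w = ((a₀,b₀), …, (aₙ,bₙ))`. The point of this file:
**in cube coordinates the label maps of a lattice path are monomial maps of cubes**,

`𝔄_w (c_n t) = c_p (S_w t)`,  `(S_w t)_a = ∏_{j : aⱼ = a, j < n} tⱼ`   (`labelMap_cubeToSimplex_fst`),
`𝔅_w (c_n t) = c_q (T_w t)`,  `(T_w t)_b = ∏_{j : bⱼ = b, j < n} tⱼ`   (`labelMap_cubeToSimplex_snd`),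

so that the cube parametrisation of a shuffle simplex factors as
`(σ.cubeMap ∘ S_w, τ.cubeMap ∘ T_w)` through the product of the cube parametrisations of `σ` and
`τ` (recorded in the sequel with the manifold-side statements). The maps `S_w = cubeS`, `T_w = cubeT`
are polynomial (`contDiff_cubeS`, `contDiff_cubeT`), send the cube into the cube
(`cubeS_mem_unitCube`, `cubeT_mem_unitCube`), and obey the **cone recursion** of the shuffle chains
(`cubeS_consR`, `cubeT_consR`, `cubeS_consU`, `cubeT_consU`): after an initial right-step,
`S_w(t₀,t') = (t₀, S_v t')` and `T_w(t₀,t') = (t₀ (T_v t')₀, (T_v t')_{≥1})`, and symmetrically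
after an up-step — the recursion through which the shuffle sum of integrals is evaluated by
one-variable substitutions in the sequel.

Everything is proved; no named facts.

## References

* S. Eilenberg, S. Mac Lane, On the groups `H(Π,n)`. I, Ann. of Math. 58 (1953), §5. [folklore attribution]
* A. Hatcher, *Algebraic Topology*, CUP 2002, §3.B pp. 277–278. [HatcherAT2002]
-/

noncomputable section

open Finset Set

namespace Literature.Geometry.Manifold

open Literature.AlgebraicTopology.SingularHomology Literature.AlgebraicTopology.SingularHomology.ShuffleChains

variable {n : ℕ}

/-! ### The label maps of a tuple of lattice points -/

/-- **The linear vertex-label map** `x ↦ (∑_{j : a j = i} xⱼ)ᵢ : ℝⁿ⁺¹ → ℝᵖ⁺¹` of a tuple of labels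
`a : Fin (n+1) → ℕ` — the linear extension of the affine simplex `[e_{a₀}, …, e_{aₙ}] : Δⁿ → Δᵖ`
(labels `> p` are dropped; they do not occur on lattice paths). [folklore] -/
def labelMap (p : ℕ) (a : Fin (n + 1) → ℕ) (x : Fin (n + 1) → ℝ) : Fin (p + 1) → ℝ :=
  fun i ↦ ∑ j ∈ univ.filter (fun j ↦ a j = i), x j

/-- The label map is additive. [folklore] -/
theorem labelMap_add (p : ℕ) (a : Fin (n + 1) → ℕ) (x y : Fin (n + 1) → ℝ) :
    labelMap p a (x + y) = labelMap p a x + labelMap p a y := by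
  funext i
  simp [labelMap, Finset.sum_add_distrib]

/-- The label map is homogeneous. [folklore] -/
theorem labelMap_smul (p : ℕ) (a : Fin (n + 1) → ℕ) (c : ℝ) (x : Fin (n + 1) → ℝ) :
    labelMap p a (c • x) = c • labelMap p a x := by
  funext i
  simp [labelMap, Finset.mul_sum]

/-! ### The monomial cube maps of a tuple -/

/-- The steps of a tuple `w` whose source vertex lies in column `a`. [folklore] -/
def colSteps (w : Fin (n + 1) → V) (a : ℕ) : Finset (Fin n) := univ.filter fun j ↦ (w j.castSucc).1 = a

/-- The steps of a tuple `w` whose source vertex lies in row `b`. [folklore] -/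
def rowSteps (w : Fin (n + 1) → V) (b : ℕ) : Finset (Fin n) := univ.filter fun j ↦ (w j.castSucc).2 = b

/-- **The cube map of the first factor**: `(S_w t)_a = ∏_{j ∈ colSteps w a} tⱼ`. [folklore] -/
def cubeS (p : ℕ) (w : Fin (n + 1) → V) (t : Fin n → ℝ) : Fin p → ℝ := fun a ↦ ∏ j ∈ colSteps w (a : ℕ), t j

/-- **The cube map of the second factor**: `(T_w t)_b = ∏_{j ∈ rowSteps w b} tⱼ`. [folklore] -/
def cubeT (q : ℕ) (w : Fin (n + 1) → V) (t : Fin n → ℝ) : Fin q → ℝ := fun b ↦ ∏ j ∈ rowSteps w (b : ℕ), t j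

/-- The cube map of the first factor is polynomial, hence `C^∞`. [folklore] -/
theorem contDiff_cubeS {m : WithTop ℕ∞} (p : ℕ) (w : Fin (n + 1) → V) : ContDiff ℝ m (cubeS p w) :=
  contDiff_pi.mpr fun _ ↦ contDiff_prod fun j _ ↦ contDiff_apply ℝ ℝ j

/-- The cube map of the second factor is polynomial, hence `C^∞`. [folklore] -/
theorem contDiff_cubeT {m : WithTop ℕ∞} (q : ℕ) (w : Fin (n + 1) → V) : ContDiff ℝ m (cubeT q w) :=
  contDiff_pi.mpr fun _ ↦ contDiff_prod fun j _ ↦ contDiff_apply ℝ ℝ j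

/-- `S_w` maps the cube into the cube. [folklore] -/
theorem cubeS_mem_unitCube (p : ℕ) (w : Fin (n + 1) → V) {t : Fin n → ℝ} (ht : t ∈ Icc (0 : Fin n → ℝ) 1) :
    cubeS p w t ∈ Icc (0 : Fin p → ℝ) 1 :=
  ⟨fun _ ↦ Finset.prod_nonneg fun j _ ↦ ht.1 j, fun _ ↦ Finset.prod_le_one (fun j _ ↦ ht.1 j) fun j _ ↦ ht.2 j⟩

/-- `T_w` maps the cube into the cube. [folklore] -/
theorem cubeT_mem_unitCube (q : ℕ) (w : Fin (n + 1) → V) {t : Fin n → ℝ} (ht : t ∈ Icc (0 : Fin n → ℝ) 1) :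
    cubeT q w t ∈ Icc (0 : Fin q → ℝ) 1 :=
  ⟨fun _ ↦ Finset.prod_nonneg fun j _ ↦ ht.1 j, fun _ ↦ Finset.prod_le_one (fun j _ ↦ ht.1 j) fun j _ ↦ ht.2 j⟩

/-! ### The cone recursion of the index sets -/

section Recursion

variable (v : Fin (n + 1) → V)

/-- After an initial right-step, column `0` contains exactly the first step. [folklore] -/
theorem colSteps_consR_zero : colSteps (Fin.cons o (faceR 0 ∘ v) : Fin (n + 2) → V) 0 = {0} := by
  ext j
  simp only [colSteps, Finset.mem_filter, Finset.mem_univ, true_and, Finset.mem_singleton]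
  refine Fin.cases (by simp) (fun i ↦ ?_) j
  simp only [← Fin.succ_castSucc, Fin.cons_succ, Function.comp_apply, faceR_apply, skip_zero]
  constructor
  · intro h; omega
  · intro h; exact absurd h (Fin.succ_ne_zero i)

/-- After an initial right-step, column `a + 1` consists of the shifted steps of column `a` of the rest. [folklore] -/
theorem colSteps_consR_succ (a : ℕ) :
    colSteps (Fin.cons o (faceR 0 ∘ v) : Fin (n + 2) → V) (a + 1) = (colSteps v a).map (Fin.succEmb n) := by
  ext j
  simp only [colSteps, Finset.mem_filter, Finset.mem_univ, true_and, Finset.mem_map, Fin.coe_succEmb]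
  refine Fin.cases (by simp) (fun i ↦ ?_) j
  simp only [← Fin.succ_castSucc, Fin.cons_succ, Function.comp_apply, faceR_apply, skip_zero, Fin.succ_inj,
    exists_eq_right]
  omega

/-- After an initial right-step, row `0` consists of the first step and the shifted steps of row `0` of the rest. [folklore] -/
theorem rowSteps_consR_zero :
    rowSteps (Fin.cons o (faceR 0 ∘ v) : Fin (n + 2) → V) 0 = insert 0 ((rowSteps v 0).map (Fin.succEmb n)) := by
  ext j
  simp only [rowSteps, Finset.mem_filter, Finset.mem_univ, true_and, Finset.mem_insert, Finset.mem_map,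
    Fin.coe_succEmb]
  refine Fin.cases (by simp) (fun i ↦ ?_) j
  simp only [← Fin.succ_castSucc, Fin.cons_succ, Function.comp_apply, faceR_apply, Fin.succ_ne_zero, false_or,
    Fin.succ_inj, exists_eq_right]

/-- After an initial right-step, row `b + 1` consists of the shifted steps of row `b + 1` of the rest. [folklore] -/
theorem rowSteps_consR_succ (b : ℕ) :
    rowSteps (Fin.cons o (faceR 0 ∘ v) : Fin (n + 2) → V) (b + 1) = (rowSteps v (b + 1)).map (Fin.succEmb n) := by
  ext j
  simp only [rowSteps, Finset.mem_filter, Finset.mem_univ, true_and, Finset.mem_map, Fin.coe_succEmb]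
  refine Fin.cases (by simp) (fun i ↦ ?_) j
  simp only [← Fin.succ_castSucc, Fin.cons_succ, Function.comp_apply, faceR_apply, Fin.succ_inj, exists_eq_right]

/-- After an initial up-step, row `0` contains exactly the first step. [folklore] -/
theorem rowSteps_consU_zero : rowSteps (Fin.cons o (faceU 0 ∘ v) : Fin (n + 2) → V) 0 = {0} := by
  ext j
  simp only [rowSteps, Finset.mem_filter, Finset.mem_univ, true_and, Finset.mem_singleton]
  refine Fin.cases (by simp) (fun i ↦ ?_) j
  simp only [← Fin.succ_castSucc, Fin.cons_succ, Function.comp_apply, faceU_apply, skip_zero]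
  constructor
  · intro h; omega
  · intro h; exact absurd h (Fin.succ_ne_zero i)

/-- After an initial up-step, row `b + 1` consists of the shifted steps of row `b` of the rest. [folklore] -/
theorem rowSteps_consU_succ (b : ℕ) :
    rowSteps (Fin.cons o (faceU 0 ∘ v) : Fin (n + 2) → V) (b + 1) = (rowSteps v b).map (Fin.succEmb n) := by
  ext j
  simp only [rowSteps, Finset.mem_filter, Finset.mem_univ, true_and, Finset.mem_map, Fin.coe_succEmb]
  refine Fin.cases (by simp) (fun i ↦ ?_) j
  simp only [← Fin.succ_castSucc, Fin.cons_succ, Function.comp_apply, faceU_apply, skip_zero, Fin.succ_inj,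
    exists_eq_right]
  omega

/-- After an initial up-step, column `0` consists of the first step and the shifted steps of column `0` of the rest. [folklore] -/
theorem colSteps_consU_zero :
    colSteps (Fin.cons o (faceU 0 ∘ v) : Fin (n + 2) → V) 0 = insert 0 ((colSteps v 0).map (Fin.succEmb n)) := by
  ext j
  simp only [colSteps, Finset.mem_filter, Finset.mem_univ, true_and, Finset.mem_insert, Finset.mem_map,
    Fin.coe_succEmb]
  refine Fin.cases (by simp) (fun i ↦ ?_) j
  simp only [← Fin.succ_castSucc, Fin.cons_succ, Function.comp_apply, faceU_apply, Fin.succ_ne_zero, false_or,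
    Fin.succ_inj, exists_eq_right]

/-- After an initial up-step, column `a + 1` consists of the shifted steps of column `a + 1` of the rest. [folklore] -/
theorem colSteps_consU_succ (a : ℕ) :
    colSteps (Fin.cons o (faceU 0 ∘ v) : Fin (n + 2) → V) (a + 1) = (colSteps v (a + 1)).map (Fin.succEmb n) := by
  ext j
  simp only [colSteps, Finset.mem_filter, Finset.mem_univ, true_and, Finset.mem_map, Fin.coe_succEmb]
  refine Fin.cases (by simp) (fun i ↦ ?_) j
  simp only [← Fin.succ_castSucc, Fin.cons_succ, Function.comp_apply, faceU_apply, Fin.succ_inj, exists_eq_right]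

/-- **Cone recursion, right-step, first factor**: `S_w(t₀, t') = (t₀, S_v t')`. [folklore] -/
theorem cubeS_consR (p : ℕ) (t : Fin (n + 1) → ℝ) :
    cubeS (p + 1) (Fin.cons o (faceR 0 ∘ v) : Fin (n + 2) → V) t = Fin.cons (t 0) (cubeS p v (Fin.tail t)) := by
  funext a
  refine Fin.cases ?_ (fun a' ↦ ?_) a
  · simp [cubeS, colSteps_consR_zero]
  · simp [cubeS, colSteps_consR_succ, Finset.prod_map, Fin.tail]

/-- **Cone recursion, right-step, second factor** (positive `q`): `T_w(t₀,t') = (t₀ (T_v t')₀, (T_v t')_{≥1})`. [folklore] -/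
theorem cubeT_consR (q : ℕ) (t : Fin (n + 1) → ℝ) :
    cubeT (q + 1) (Fin.cons o (faceR 0 ∘ v) : Fin (n + 2) → V) t =
      Fin.cons (t 0 * cubeT (q + 1) v (Fin.tail t) 0) (Fin.tail (cubeT (q + 1) v (Fin.tail t))) := by
  funext b
  refine Fin.cases ?_ (fun b' ↦ ?_) b
  · simp only [Fin.cons_zero, cubeT, Fin.val_zero]
    rw [rowSteps_consR_zero, Finset.prod_insert (by simp), Finset.prod_map]
    rfl
  · simp [cubeT, rowSteps_consR_succ, Finset.prod_map, Fin.tail]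

/-- **Cone recursion, up-step, second factor**: `T_w(t₀, t') = (t₀, T_v t')`. [folklore] -/
theorem cubeT_consU (q : ℕ) (t : Fin (n + 1) → ℝ) :
    cubeT (q + 1) (Fin.cons o (faceU 0 ∘ v) : Fin (n + 2) → V) t = Fin.cons (t 0) (cubeT q v (Fin.tail t)) := by
  funext b
  refine Fin.cases ?_ (fun b' ↦ ?_) b
  · simp [cubeT, rowSteps_consU_zero]
  · simp [cubeT, rowSteps_consU_succ, Finset.prod_map, Fin.tail]

/-- **Cone recursion, up-step, first factor** (positive `p`): `S_w(t₀,t') = (t₀ (S_v t')₀, (S_v t')_{≥1})`. [folklore] -/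
theorem cubeS_consU (p : ℕ) (t : Fin (n + 1) → ℝ) :
    cubeS (p + 1) (Fin.cons o (faceU 0 ∘ v) : Fin (n + 2) → V) t =
      Fin.cons (t 0 * cubeS (p + 1) v (Fin.tail t) 0) (Fin.tail (cubeS (p + 1) v (Fin.tail t))) := by
  funext a
  refine Fin.cases ?_ (fun a' ↦ ?_) a
  · simp only [Fin.cons_zero, cubeS, Fin.val_zero]
    rw [colSteps_consU_zero, Finset.prod_insert (by simp), Finset.prod_map]
    rfl
  · simp [cubeS, colSteps_consU_succ, Finset.prod_map, Fin.tail]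

/-- The label map coordinatewise, as a sum with indicator. [folklore] -/
theorem labelMap_apply (p : ℕ) (a : Fin (n + 1) → ℕ) (x : Fin (n + 1) → ℝ) (i : Fin (p + 1)) :
    labelMap p a x i = ∑ j, if a j = i then x j else 0 := by
  rw [labelMap, Finset.sum_filter]

/-- The label map of the first coordinates after an initial right-step: `𝔄_w (x₀, x') = (x₀, 𝔄_v x')`. [folklore] -/
theorem labelMap_fst_consR (p : ℕ) (x : Fin (n + 2) → ℝ) :
    labelMap (p + 1) (Prod.fst ∘ (Fin.cons o (faceR 0 ∘ v) : Fin (n + 2) → V)) x =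
      Fin.cons (x 0) (labelMap p (Prod.fst ∘ v) (Fin.tail x)) := by
  funext i
  refine Fin.cases ?_ (fun i' ↦ ?_) i
  · rw [labelMap_apply, Fin.sum_univ_succ, Fin.cons_zero]
    simp
  · rw [labelMap_apply, Fin.sum_univ_succ, Fin.cons_succ, labelMap_apply]
    simp only [Function.comp_apply, Fin.cons_zero, Fin.val_succ, Fin.cons_succ, faceR_apply, skip_zero, Fin.tail]
    rw [if_neg (by simp), zero_add]
    refine Finset.sum_congr rfl fun j _ ↦ ?_
    simp only [add_left_inj]

/-- The label map of the first coordinates after an initial up-step: `𝔄_w (x₀, x') = x₀ e₀ + 𝔄_v x'`. [folklore] -/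
theorem labelMap_fst_consU (p : ℕ) (x : Fin (n + 2) → ℝ) :
    labelMap p (Prod.fst ∘ (Fin.cons o (faceU 0 ∘ v) : Fin (n + 2) → V)) x =
      x 0 • Pi.single 0 1 + labelMap p (Prod.fst ∘ v) (Fin.tail x) := by
  funext i
  simp only [labelMap_apply, Fin.sum_univ_succ, Pi.add_apply, Pi.smul_apply, Function.comp_apply, Fin.cons_zero,
    Fin.cons_succ, faceU_apply, Fin.tail, smul_eq_mul, Pi.single_apply, mul_ite, mul_one, mul_zero]
  congr 1
  by_cases hi : i = 0
  · subst hi; simp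
  · rw [if_neg hi, if_neg]
    exact fun h ↦ hi (Fin.ext (by simpa using h.symm))

/-- The label map of the second coordinates after an initial up-step: `𝔅_w (x₀, x') = (x₀, 𝔅_v x')`. [folklore] -/
theorem labelMap_snd_consU (q : ℕ) (x : Fin (n + 2) → ℝ) :
    labelMap (q + 1) (Prod.snd ∘ (Fin.cons o (faceU 0 ∘ v) : Fin (n + 2) → V)) x =
      Fin.cons (x 0) (labelMap q (Prod.snd ∘ v) (Fin.tail x)) := by
  funext i
  refine Fin.cases ?_ (fun i' ↦ ?_) i
  · rw [labelMap_apply, Fin.sum_univ_succ, Fin.cons_zero]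
    simp
  · rw [labelMap_apply, Fin.sum_univ_succ, Fin.cons_succ, labelMap_apply]
    simp only [Function.comp_apply, Fin.cons_zero, Fin.val_succ, Fin.cons_succ, faceU_apply, skip_zero, Fin.tail]
    rw [if_neg (by simp), zero_add]
    refine Finset.sum_congr rfl fun j _ ↦ ?_
    simp only [add_left_inj]

/-- The label map of the second coordinates after an initial right-step: `𝔅_w (x₀, x') = x₀ e₀ + 𝔅_v x'`. [folklore] -/
theorem labelMap_snd_consR (q : ℕ) (x : Fin (n + 2) → ℝ) :
    labelMap q (Prod.snd ∘ (Fin.cons o (faceR 0 ∘ v) : Fin (n + 2) → V)) x =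
      x 0 • Pi.single 0 1 + labelMap q (Prod.snd ∘ v) (Fin.tail x) := by
  funext i
  simp only [labelMap_apply, Fin.sum_univ_succ, Pi.add_apply, Pi.smul_apply, Function.comp_apply, Fin.cons_zero,
    Fin.cons_succ, faceR_apply, Fin.tail, smul_eq_mul, Pi.single_apply, mul_ite, mul_one, mul_zero]
  congr 1
  by_cases hi : i = 0
  · subst hi; simp
  · rw [if_neg hi, if_neg]
    exact fun h ↦ hi (Fin.ext (by simpa using h.symm))

end Recursion

/-! ### The label maps in cube coordinates -/

/-- The cone step in cube coordinates: `(1 - t₀) e₀ + t₀ c_p(s) = c_p(t₀ s₀, s_{≥1})` for the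
collapse `c_{p'+1}`; as a vector identity. [folklore] -/
theorem cone_cubeToSimplex_succ (p' : ℕ) (t₀ : ℝ) (s : Fin (p' + 1) → ℝ) :
    (1 - t₀) • (Pi.single 0 1 : Fin (p' + 2) → ℝ) + t₀ • cubeToSimplex (p' + 1) s =
      cubeToSimplex (p' + 1) (Fin.cons (t₀ * s 0) (Fin.tail s)) := by
  rw [cubeToSimplex_succ, cubeToSimplex_succ]
  funext i
  refine Fin.cases ?_ (fun i' ↦ ?_) i
  · simp only [Pi.add_apply, Pi.smul_apply, Pi.single_eq_same, Fin.cons_zero, smul_eq_mul]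
    ring
  · simp only [Pi.add_apply, Pi.smul_apply, Fin.cons_succ, smul_eq_mul, mul_zero, zero_add, Fin.tail_cons,
      Fin.cons_zero, Pi.single_apply, Fin.succ_ne_zero, if_false]
    ring

/-- In degree `0` the collapse is the point `1`, whatever the (empty) argument. [folklore] -/
theorem cubeToSimplex_zero_eq (s s' : Fin 0 → ℝ) : cubeToSimplex 0 s = cubeToSimplex 0 s' := rfl

/-- **The first label map in cube coordinates**: along a tuple of `shuffle n p`,
`𝔄_w (c_n t) = c_p (S_w t)` for all `t`. [folklore] -/
theorem labelMap_cubeToSimplex_fst : ∀ {n p : ℕ} {w : Fin (n + 1) → V}, w ∈ (shuffle n p).support →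
    ∀ t : Fin n → ℝ, labelMap p (Prod.fst ∘ w) (cubeToSimplex n t) = cubeToSimplex p (cubeS p w t)
  | 0, 0, w, hw, t => by
    classical
    have h := Finsupp.support_single_subset (shuffle_zero_zero ▸ hw)
    rw [Finset.mem_singleton] at h
    subst h
    funext i
    simp [labelMap_apply, cubeToSimplex_zero]
  | 0, p + 1, w, hw, t => by simp at hw
  | n + 1, p, w, hw, t => by
    classical
    rcases p with _ | p'
    · -- only up-steps: `w = cons o (U₀ ∘ v)`
      rw [shuffle_succ_zero] at hw
      obtain ⟨v, hv, rfl⟩ := exists_of_mem_support_cone_push hw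
      rw [labelMap_fst_consU]
      funext i
      have hi : i = 0 := Fin.fin_one_eq_zero i
      subst hi
      have ih := congrFun (labelMap_cubeToSimplex_fst hv (Fin.tail t)) 0
      simp only [cubeToSimplex_zero] at ih ⊢
      rw [Pi.add_apply, Pi.smul_apply, Pi.single_eq_same, cubeToSimplex_succ, Fin.cons_zero, Fin.tail_cons,
        labelMap_smul, Pi.smul_apply, ih]
      simp
    · rw [shuffle_succ_succ] at hw
      rcases Finset.mem_union.mp (Finsupp.support_add hw) with h | h
      · -- right-step first
        obtain ⟨v, hv, rfl⟩ := exists_of_mem_support_cone_push h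
        rw [labelMap_fst_consR, cubeS_consR, cubeToSimplex_succ (Fin.cons (t 0) _), Fin.cons_zero, Fin.tail_cons,
          ← labelMap_cubeToSimplex_fst hv (Fin.tail t), cubeToSimplex_succ, Fin.cons_zero, Fin.tail_cons,
          labelMap_smul]
      · -- up-step first
        obtain ⟨v, hv, rfl⟩ := exists_of_mem_support_cone_push (Finsupp.support_smul h)
        rw [labelMap_fst_consU, cubeS_consU, cubeToSimplex_succ t, Fin.cons_zero, Fin.tail_cons, labelMap_smul,
          labelMap_cubeToSimplex_fst hv (Fin.tail t), cone_cubeToSimplex_succ]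

/-- **The second label map in cube coordinates**: along a tuple of `shuffle n p` with `p + q = n`,
`𝔅_w (c_n t) = c_q (T_w t)` for all `t`. [folklore] -/
theorem labelMap_cubeToSimplex_snd : ∀ {n p q : ℕ} {w : Fin (n + 1) → V}, p + q = n → w ∈ (shuffle n p).support →
    ∀ t : Fin n → ℝ, labelMap q (Prod.snd ∘ w) (cubeToSimplex n t) = cubeToSimplex q (cubeT q w t)
  | 0, 0, q, w, hq, hw, t => by
    classical
    obtain rfl : q = 0 := by omega
    have h := Finsupp.support_single_subset (shuffle_zero_zero ▸ hw)
    rw [Finset.mem_singleton] at h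
    subst h
    funext i
    simp [labelMap_apply, cubeToSimplex_zero]
  | 0, p + 1, q, w, _, hw, t => by simp at hw
  | n + 1, p, q, w, hq, hw, t => by
    classical
    rcases p with _ | p'
    · -- only up-steps
      obtain rfl : q = n + 1 := by omega
      rw [shuffle_succ_zero] at hw
      obtain ⟨v, hv, rfl⟩ := exists_of_mem_support_cone_push hw
      rw [labelMap_snd_consU, cubeT_consU, cubeToSimplex_succ (Fin.cons (t 0) _), Fin.cons_zero, Fin.tail_cons,
        ← labelMap_cubeToSimplex_snd (p := 0) (q := n) (zero_add n) hv (Fin.tail t), cubeToSimplex_succ, Fin.cons_zero,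
        Fin.tail_cons, labelMap_smul]
    · rw [shuffle_succ_succ] at hw
      rcases Finset.mem_union.mp (Finsupp.support_add hw) with h | h
      · -- right-step first: `v ∈ shuffle n p'`, `p' + q = n`
        obtain ⟨v, hv, rfl⟩ := exists_of_mem_support_cone_push h
        rcases q with _ | q'
        · -- no up-steps at all: every second label is `0`, and the barycentric coordinates sum to `1`
          have hw' : Fin.cons o (faceR 0 ∘ v) ∈ (shuffle (n + 1) (p' + 1)).support := by
            rw [shuffle_succ_succ]; exact hw
          have hbox := vertsIn_shuffle (n + 1) (p' + 1) _ hw'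
          funext i
          rw [labelMap_apply, cubeToSimplex_zero]
          rw [Finset.sum_congr rfl fun j _ ↦ if_pos (by have := (hbox j).2; simp only [Function.comp_apply]; omega),
            sum_cubeToSimplex]
        · rw [labelMap_snd_consR, cubeT_consR, cubeToSimplex_succ t, Fin.cons_zero, Fin.tail_cons, labelMap_smul,
            labelMap_cubeToSimplex_snd (by omega) hv (Fin.tail t), cone_cubeToSimplex_succ]
      · -- up-step first: `v ∈ shuffle n (p'+1)`, `p' + 1 + (q - 1) = n`
        obtain ⟨v, hv, rfl⟩ := exists_of_mem_support_cone_push (Finsupp.support_smul h)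
        rcases q with _ | q'
        · exfalso
          have : shuffle n (p' + 1) = 0 := shuffle_eq_zero_of_lt (by omega)
          rw [this] at hv
          simp at hv
        · rw [labelMap_snd_consU, cubeT_consU, cubeToSimplex_succ (Fin.cons (t 0) _), Fin.cons_zero, Fin.tail_cons,
            ← labelMap_cubeToSimplex_snd (by omega) hv (Fin.tail t), cubeToSimplex_succ, Fin.cons_zero, Fin.tail_cons,
            labelMap_smul]

end Literature.Geometry.Manifold
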